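import Summits.CriticalPhenomena.Ising3DConformalLimit.Theses.LocalisationClock
import Summits.CriticalPhenomena.Ising3DConformalLimit.Theorems.LeeYangGapGaussianLimitKillsBlockCoupling

/-!
# A Gaussian scale-covariant pointwise limit kills the block Binder coupling — route LocalisationClock
(shared transfer glue, item stmt-CriticalPhenomena-15886 `GaussianLimitKillsBlockCoupling`: PROOF)

The route decl `LocalisationClock.GaussianLimitKillsBlockCoupling` has the same definiens as the
PROVED item stmt-CriticalPhenomena-4950 of route LeeYangGap (`LeeYangGap.GaussianLimitKillsBlockCoupling`,
proof `LeeYangGapGaussianLimitKillsBlockCoupling.gaussianLimitKillsBlockCoupling_proof`: Aizenman's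
dimension count for block sums — Ursell identity `3Σ_L² - ⟨M_L⁴⟩ = -Σ_{Λ_L⁴} U₄`, near/far split with
the Lebowitz–Griffiths pairing bound, dyadic doubling of the axis two-point function from scale
covariance with `Δ ≤ 1`, far smallness from `U₄^S ≡ 0`). The two propositions are `Iff.rfl`; this file
transfers the in-tree term (crux-strategist census `Cruxes/GaussianLimitKillsBlockCoupling/STRATEGY-CENSUS.md`,
line `Lines/twin_transfer.lean`).

## References

* M. Aizenman, CDM 2020 (arXiv:2112.04248), §10.1 [AizenmanCDM2020].
* M. Aizenman, H. Duminil-Copin, Ann. Math. 194 (2021), Prop. 1.4 (U₄ criterion), eq. (3.12)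
  [AizenmanDuminilCopinAnnals2021].
-/

namespace Summit.CriticalPhenomena.Ising3DConformalLimit.LocalisationClockGaussianLimitKillsBlockCoupling

/-- The two route statements `LocalisationClock.GaussianLimitKillsBlockCoupling` and
`LeeYangGap.GaussianLimitKillsBlockCoupling` are one proposition (identical definientia). -/
theorem iff_leeYangGap :
    Summit.CriticalPhenomena.Ising3DConformalLimit.Theses.LocalisationClock.GaussianLimitKillsBlockCoupling ↔
      Summit.CriticalPhenomena.Ising3DConformalLimit.Theses.LeeYangGap.GaussianLimitKillsBlockCoupling :=
  Iff.rfl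

/-- **Item stmt-CriticalPhenomena-15886, literally the route decl.** If `(ρ, Δ, S)` is a pointwise
scaling limit of `criticalCorr 3` (`ρ > 0` on `(0,1]`) with non-degenerate two-point function, scale
covariant with dimension `Δ`, and `U₄^S ≡ 0` off coincidences, then the critical block Binder coupling
`g_L = (3⟨M_L²⟩² - ⟨M_L⁴⟩)/⟨M_L²⟩²` on `ℤ³` tends to `0` — by transfer of the twin item's proof
(stmt-CriticalPhenomena-4950, route LeeYangGap). -/
theorem gaussianLimitKillsBlockCoupling_proof :
    Summit.CriticalPhenomena.Ising3DConformalLimit.Theses.LocalisationClock.GaussianLimitKillsBlockCoupling :=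
  iff_leeYangGap.2
    Summit.CriticalPhenomena.Ising3DConformalLimit.LeeYangGapGaussianLimitKillsBlockCoupling.gaussianLimitKillsBlockCoupling_proof

end Summit.CriticalPhenomena.Ising3DConformalLimit.LocalisationClockGaussianLimitKillsBlockCoupling
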